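import Literature.Probability.Percolation.Percolation
import HarnessLib

/-!
# REVIEW-RUNBOOK sanity lemmas — the infimum defining `criticalProb` is a genuine infimum
# (clients `prim-primary`, `prim-slab`, `pub-peel`, `pub-corpus`, `pub-lace`, `pub-lace10` of the ops
# review-runbook generator; §2 card `criticalProb`)

`Literature.Probability.Percolation.criticalProb G x` is
`sInf ({p : ℝ | ∃ h : p ∈ unitInterval, 0 < theta G x ⟨p, h⟩} ∪ {1})`.  Over `ℝ`, Mathlib's `sInf`
returns the DEFAULT `0` for an empty set or a set not bounded below, and every statement through
`criticalProb` silently includes that case; the runbooks' §2 card for `criticalProb` («Conventional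
values in reach») asks for the one fact that removes the question: the defining set is NON-EMPTY
(it contains `1`, by the `∪ {1}` convention of the definition) and BOUNDED BELOW (by `0`: its other
members are points of `unitInterval`).  So `p_c(G, x)` is the genuine greatest lower bound of that
set for EVERY graph and vertex — finite or infinite, percolating or not — and `0 ≤ p_c ≤ 1`
(the tree's `criticalProb_mem_Icc`, whose proof uses the same two facts without naming them).

Review evidence only (supports the cell's closed crux item as reviewer evidence, closes nothing);
no definitions, no `sorry`, standard axioms.
-/

namespace Summit.CriticalPhenomena.PercolationContinuityZ3.Theorems.RunbookCriticalProb

open Literature.Probability.Percolation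

variable {V : Type*}

/-- `1` is a member of the defining set of `criticalProb G x` (the `∪ {1}` convention). [folklore] -/
theorem one_mem_criticalProb_set (G : SimpleGraph V) (x : V) :
    (1 : ℝ) ∈ ({p : ℝ | ∃ h : p ∈ unitInterval, 0 < theta G x ⟨p, h⟩} ∪ {1}) :=
  Or.inr rfl

/-- **The defining set of `criticalProb G x` is non-empty** (it contains `1`). [folklore] -/
theorem criticalProb_set_nonempty (G : SimpleGraph V) (x : V) :
    ({p : ℝ | ∃ h : p ∈ unitInterval, 0 < theta G x ⟨p, h⟩} ∪ {1}).Nonempty :=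
  ⟨1, one_mem_criticalProb_set G x⟩

/-- Every member of the defining set of `criticalProb G x` is `≥ 0`. [folklore] -/
theorem zero_le_of_mem_criticalProb_set (G : SimpleGraph V) (x : V) {p : ℝ}
    (hp : p ∈ ({p : ℝ | ∃ h : p ∈ unitInterval, 0 < theta G x ⟨p, h⟩} ∪ {1})) : 0 ≤ p := by
  rcases hp with ⟨h, -⟩ | h
  · exact h.1
  · rw [Set.mem_singleton_iff] at h
    rw [h]; exact zero_le_one

/-- Every member of the defining set of `criticalProb G x` is `≤ 1`. [folklore] -/
theorem le_one_of_mem_criticalProb_set (G : SimpleGraph V) (x : V) {p : ℝ}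
    (hp : p ∈ ({p : ℝ | ∃ h : p ∈ unitInterval, 0 < theta G x ⟨p, h⟩} ∪ {1})) : p ≤ 1 := by
  rcases hp with ⟨h, -⟩ | h
  · exact h.2
  · rw [Set.mem_singleton_iff] at h
    rw [h]

/-- **The defining set of `criticalProb G x` is bounded below** (by `0`). [folklore] -/
theorem criticalProb_set_bddBelow (G : SimpleGraph V) (x : V) :
    BddBelow ({p : ℝ | ∃ h : p ∈ unitInterval, 0 < theta G x ⟨p, h⟩} ∪ {1}) :=
  ⟨0, fun _ hp => zero_le_of_mem_criticalProb_set G x hp⟩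

/-- The defining set of `criticalProb G x` is bounded above (by `1`) — recorded for completeness;
the infimum needs only the lower bound. [folklore] -/
theorem criticalProb_set_bddAbove (G : SimpleGraph V) (x : V) :
    BddAbove ({p : ℝ | ∃ h : p ∈ unitInterval, 0 < theta G x ⟨p, h⟩} ∪ {1}) :=
  ⟨1, fun _ hp => le_one_of_mem_criticalProb_set G x hp⟩

/-- **Side fact for the §2 card `criticalProb`, in the generator's printed shape**: the defining set
is bounded below AND non-empty — over `ℝ` exactly what makes `sInf` the genuine greatest lower bound
(`Real.sInf_def` / `csInf_le` / `le_csInf` apply), for every graph `G` and vertex `x`. [folklore] -/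
theorem criticalProb_bddBelow_nonempty (G : SimpleGraph V) (x : V) :
    BddBelow ({p : ℝ | ∃ h : p ∈ unitInterval, 0 < theta G x ⟨p, h⟩} ∪ {1}) ∧
      ({p : ℝ | ∃ h : p ∈ unitInterval, 0 < theta G x ⟨p, h⟩} ∪ {1}).Nonempty :=
  ⟨criticalProb_set_bddBelow G x, criticalProb_set_nonempty G x⟩

/-- `criticalProb G x` is the GREATEST LOWER BOUND of its defining set (not a default value).
[folklore] -/
theorem isGLB_criticalProb (G : SimpleGraph V) (x : V) :
    IsGLB ({p : ℝ | ∃ h : p ∈ unitInterval, 0 < theta G x ⟨p, h⟩} ∪ {1}) (criticalProb G x) :=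
  isGLB_csInf (criticalProb_set_nonempty G x) (criticalProb_set_bddBelow G x)

/-- Consequently `p_c ≤ p` for every `p ∈ [0, 1]` with `θ_x(p) > 0` (the infimum bounds each member).
[folklore] -/
theorem criticalProb_le_of_theta_pos (G : SimpleGraph V) (x : V) (p : unitInterval)
    (hp : 0 < theta G x p) : criticalProb G x ≤ (p : ℝ) :=
  csInf_le (criticalProb_set_bddBelow G x) (Or.inl ⟨p.2, by simpa using hp⟩)

end Summit.CriticalPhenomena.PercolationContinuityZ3.Theorems.RunbookCriticalProb
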